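import Summits.CriticalPhenomena.PercolationContinuityZ3.Theorems.PercNearOneGluingNoHeavyPcintOSMRenewal
import HarnessLib

/-!
# PCINT lane, PHASE 4 (kernel second-moment oriented route), site version, step 1: shared vertices and the renewal bound

Cell `prim-pcint`, seat `prim-pcint-1` (gen 13); memo `run/shared/lean/prim/pcint/T-FIBRE-ROUTE.md` §PHASE 4.

The SITE analogue of `…OSMRenewal`: two oriented paths coded by `w, w' : Fin n → Fin d` share the VERTICES at the times
`i + 1` (`i : Fin n`) where the walkers coincide; with an offset `y` this count is `KV y w w'` and
`SV x n y = Σ_{w,w'} x^{KV y w w'}` satisfies the Duhamel identity `SV x n y = d^{2n} + (x−1) Σ_{i<n} SV x i 0 · cnt (n−i) y`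
(`SV_eq`; no shared-step factor `d`, and the lag starts at `1`), whence the renewal bound
**`OSM.SV_zero_le`**: `SV x n 0 ≤ d^{2n} / (1 − (x−1)(G−1))` whenever `Σ_{k<n} u d k ≤ G` for all `n`, `x ≥ 1` and
`(x−1)(G−1) < 1` (`u d 0 = 1` is the term removed).
-/

noncomputable section

namespace Summit.CriticalPhenomena.PercolationContinuityZ3.Theorems.Pcint.OSM

open Finset

variable {d : ℕ}

/-- **Shared vertices with offset `y`**: the indices `i` such that at time `i+1` the walker `w` started at `y` and the
walker `w'` started at `0` sit at the same vertex. -/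
def KV {n : ℕ} (y : Fin d → ℤ) (w w' : Fin n → Fin d) : ℕ :=
  (univ.filter fun i : Fin n => y + pos w ((i : ℕ) + 1) = pos w' ((i : ℕ) + 1)).card

/-- The shared-vertex count as a sum of indicators. -/
theorem KV_eq_sum {n : ℕ} (y : Fin d → ℤ) (w w' : Fin n → Fin d) :
    KV y w w' = ∑ i : Fin n, if y + pos w ((i : ℕ) + 1) = pos w' ((i : ℕ) + 1) then 1 else 0 := by
  rw [KV, Finset.card_filter]

/-- First-letter recursion of the shared-vertex count. -/
theorem KV_cons {n : ℕ} (y : Fin d → ℤ) (a a' : Fin d) (w w' : Fin n → Fin d) :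
    KV y (Fin.cons a w : Fin (n + 1) → Fin d) (Fin.cons a' w') =
      (if y + e a - e a' = 0 then 1 else 0) + KV (y + e a - e a') w w' := by
  rw [KV_eq_sum, KV_eq_sum, Fin.sum_univ_succ]
  congr 1
  · simp only [Fin.val_zero, zero_add, pos_cons_succ, pos_zero, add_zero]
    have hiff : y + e a = e a' ↔ y + e a - e a' = 0 := by
      constructor <;> intro h
      · rw [h, sub_self]
      · linear_combination h
    simp only [hiff]
  · refine Finset.sum_congr rfl fun t _ => ?_
    simp only [Fin.val_succ, pos_cons_succ]
    have hiff : y + (e a + pos w ((t : ℕ) + 1)) = e a' + pos w' ((t : ℕ) + 1) ↔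
        y + e a - e a' + pos w ((t : ℕ) + 1) = pos w' ((t : ℕ) + 1) := by
      constructor <;> intro h
      · linear_combination h
      · linear_combination h
    simp only [hiff]

/-- **`SV x n y = Σ_{w,w'} x^{KV y w w'}`** over pairs of words of length `n`. -/
def SV (d : ℕ) (x : ℝ) (n : ℕ) (y : Fin d → ℤ) : ℝ :=
  ∑ w : Fin n → Fin d, ∑ w' : Fin n → Fin d, x ^ KV y w w'

/-- Empty words share no vertex. -/
theorem SV_zero (x : ℝ) (y : Fin d → ℤ) : SV d x 0 y = 1 := by
  simp [SV, KV]

/-- First-letter recursion of `SV`. -/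
theorem SV_succ (x : ℝ) (n : ℕ) (y : Fin d → ℤ) :
    SV d x (n + 1) y = ∑ a : Fin d, ∑ a' : Fin d,
      x ^ (if y + e a - e a' = 0 then 1 else 0) * SV d x n (y + e a - e a') := by
  unfold SV
  rw [sum_word_succ]
  refine Finset.sum_congr rfl fun a _ => ?_
  simp_rw [sum_word_succ (fun w' => x ^ KV y (Fin.cons a _) w')]
  rw [Finset.sum_comm]
  refine Finset.sum_congr rfl fun a' _ => ?_
  rw [Finset.mul_sum]
  refine Finset.sum_congr rfl fun w _ => ?_
  rw [Finset.mul_sum]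
  refine Finset.sum_congr rfl fun w' _ => ?_
  rw [KV_cons, pow_add]

/-- The one-step pair count: `Σ_{a,a'} [y + e_a − e_{a'} = 0] · c = cnt 1 y · c`. -/
theorem sum_sum_ite_eq_cnt_one (y : Fin d → ℤ) (c : ℝ) :
    ∑ a : Fin d, ∑ a' : Fin d, (if y + e a - e a' = 0 then (1 : ℝ) else 0) * c = cnt d 1 y * c := by
  rw [cnt_succ, Finset.sum_mul]
  refine Finset.sum_congr rfl fun a _ => ?_
  rw [Finset.sum_mul]
  refine Finset.sum_congr rfl fun a' _ => ?_
  rw [cnt_zero]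

/-- **The Duhamel identity (site)**: `SV x n y = d^{2n} + (x−1) Σ_{i<n} SV x i 0 · cnt (n−i) y`. -/
theorem SV_eq (x : ℝ) : ∀ (n : ℕ) (y : Fin d → ℤ),
    SV d x n y = (d : ℝ) ^ (2 * n) + (x - 1) * ∑ i ∈ range n, SV d x i 0 * cnt d (n - i) y
  | 0, y => by simp [SV_zero]
  | n + 1, y => by
    rw [SV_succ]
    have hx : ∀ (a a' : Fin d), x ^ (if y + e a - e a' = 0 then 1 else 0) =
        1 + (x - 1) * (if y + e a - e a' = 0 then 1 else 0) := by
      intro a a'; split_ifs <;> simp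
    simp_rw [hx, add_mul, one_mul, Finset.sum_add_distrib]
    have hcnt : ∀ i ∈ range n, ∑ a : Fin d, ∑ a' : Fin d, cnt d (n - i) (y + e a - e a') = cnt d (n + 1 - i) y := by
      intro i hi
      have hi' : i < n := mem_range.1 hi
      have e1 : n + 1 - i = (n - i) + 1 := by omega
      rw [e1, cnt_succ]
    have h1 : ∑ a : Fin d, ∑ a' : Fin d, SV d x n (y + e a - e a') =
        (d : ℝ) ^ (2 * (n + 1)) + (x - 1) * ∑ i ∈ range n, SV d x i 0 * cnt d (n + 1 - i) y := by
      simp_rw [SV_eq x n]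
      rw [sum_sum_const_add, sum_sum_mul_sum, Finset.sum_congr rfl fun i hi => by rw [hcnt i hi]]
      ring
    have h2 : ∑ a : Fin d, ∑ a' : Fin d, (x - 1) * (if y + e a - e a' = 0 then 1 else 0) * SV d x n (y + e a - e a') =
        (x - 1) * (SV d x n 0 * cnt d 1 y) := by
      have hterm : ∀ a a' : Fin d, (x - 1) * (if y + e a - e a' = 0 then (1 : ℝ) else 0) * SV d x n (y + e a - e a') =
          (x - 1) * ((if y + e a - e a' = 0 then (1 : ℝ) else 0) * SV d x n 0) := by
        intro a a'
        by_cases h : y + e a - e a' = 0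
        · rw [if_pos h, h]; ring
        · rw [if_neg h]; ring
      simp_rw [hterm]
      rw [mul_comm (SV d x n 0) (cnt d 1 y), ← sum_sum_ite_eq_cnt_one y (SV d x n 0)]
      simp_rw [Finset.mul_sum]
    rw [h1, h2, Finset.sum_range_succ, Nat.add_sub_cancel_left]
    ring

/-- The identity at `y = 0` in normalised form: `b_n = 1 + (x−1) Σ_{i<n} b_i u_{n−i}`. -/
theorem SV_zero_div_eq (x : ℝ) (hd : 0 < d) (n : ℕ) :
    SV d x n 0 / (d : ℝ) ^ (2 * n) =
      1 + (x - 1) * ∑ i ∈ range n, SV d x i 0 / (d : ℝ) ^ (2 * i) * u d (n - i) := by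
  have hd' : (d : ℝ) ≠ 0 := by exact_mod_cast hd.ne'
  rw [SV_eq x n 0, add_div, div_self (pow_ne_zero _ hd'), Finset.mul_sum, Finset.sum_div, Finset.mul_sum]
  congr 1
  refine Finset.sum_congr rfl fun i hi => ?_
  have hi' : i < n := mem_range.1 hi
  unfold u
  have hpow : (d : ℝ) ^ (2 * n) = (d : ℝ) ^ (2 * i) * (d : ℝ) ^ (2 * (n - i)) := by
    rw [← pow_add]; congr 1; omega
  rw [hpow]
  field_simp

/-- `u d 0 = 1`. -/
theorem u_zero : u d 0 = 1 := by
  simp [u, cnt_zero]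

/-- The lag sum without the zero term: `Σ_{i<n} b u_{n−i} = b (Σ_{k<n+1} u_k − 1)` bounded by `b (G − 1)`. -/
theorem sum_u_shift_le {G : ℝ} (hG : ∀ n, ∑ k ∈ range n, u d k ≤ G) (n : ℕ) :
    ∑ i ∈ range n, u d (n - i) ≤ G - 1 := by
  have h := hG (n + 1)
  rw [Finset.sum_range_succ', u_zero] at h
  have e : ∑ i ∈ range n, u d (n - i) = ∑ k ∈ range n, u d (k + 1) := by
    rw [← Finset.sum_range_reflect (fun k => u d (k + 1)) n]
    refine Finset.sum_congr rfl fun i hi => ?_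
    congr 1; have := mem_range.1 hi; omega
  rw [e]; linarith

/-- **The renewal bound (site)**: if `Σ_{k<n} u d k ≤ G` for every `n`, `x ≥ 1` and `(x−1)(G−1) < 1`, then
`SV x n 0 ≤ d^{2n} / (1 − (x−1)(G−1))`. -/
theorem SV_zero_le {x G : ℝ} (hd : 0 < d) (hx : 1 ≤ x) (hG : ∀ n, ∑ k ∈ range n, u d k ≤ G)
    (hcG : (x - 1) * (G - 1) < 1) (n : ℕ) :
    SV d x n 0 ≤ (d : ℝ) ^ (2 * n) / (1 - (x - 1) * (G - 1)) := by
  have hdpos : (0 : ℝ) < (d : ℝ) ^ (2 * n) := by positivity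
  have hc : 0 ≤ x - 1 := by linarith
  have hB : 0 < 1 - (x - 1) * (G - 1) := by linarith
  set B := 1 / (1 - (x - 1) * (G - 1)) with hBdef
  suffices h : ∀ n, SV d x n 0 / (d : ℝ) ^ (2 * n) ≤ B by
    have := h n
    rw [div_le_iff₀ hdpos] at this
    rw [hBdef] at this
    simpa [div_eq_mul_inv, mul_comm] using this
  intro n
  induction n using Nat.strong_induction_on with
  | _ n ih =>
    rw [SV_zero_div_eq x hd n]
    have hBpos : 0 < B := by rw [hBdef]; positivity
    calc 1 + (x - 1) * ∑ i ∈ range n, SV d x i 0 / (d : ℝ) ^ (2 * i) * u d (n - i)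
        ≤ 1 + (x - 1) * ∑ i ∈ range n, B * u d (n - i) := by
          gcongr with i hi
          · exact u_nonneg _
          · exact ih i (mem_range.1 hi)
      _ = 1 + (x - 1) * (B * ∑ i ∈ range n, u d (n - i)) := by rw [← Finset.mul_sum]
      _ ≤ 1 + (x - 1) * (B * (G - 1)) := by
          gcongr
          exact sum_u_shift_le hG n
      _ = B := by
          have hBG : B * (1 - (x - 1) * (G - 1)) = 1 := by rw [hBdef, one_div, inv_mul_cancel₀ hB.ne']
          linear_combination (-1 : ℝ) * hBG

end Summit.CriticalPhenomena.PercolationContinuityZ3.Theorems.Pcint.OSM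

end
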